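import Mathlib
import HarnessLib
import HarnessLib.Audit
import Summits.MatrixMultiplication.Statement
import Literature.Computability.AlgebraicComplexity.DivisionSLP
import Literature.Computability.AlgebraicComplexity.FlatteningBound
import Summits.MatrixMultiplication.MatrixMultiplication.Theorems.CondensationDistanceDerivationsBoundOmega
import HarnessLib.Audit.Status.Attr

/-!
Route: LongExchangeCondensation

# Route LongExchangeCondensation — omega = 2 if determinants condense in quadratic weighted time by
Plücker exchanges of every arity

FORWARD route (generator = rung; seed g1-MatrixMultiplication-15939). The floor is the proved
theorem
`Summit.MatrixMultiplication.MatrixMultiplication.Theorems.CondensationSound.CondensationSound_of`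
(route CondensationDistance,
item stmt-MatrixMultiplication-15939): every valid OCTAHEDRAL derivation (three-term
Grassmann–Plücker exchange steps on the maximal minors
P_J of [I_n | X | Y], each costing 5 Ω-steps) listing the target set [n,2n) certifies det X_n in 5·l
Ω-steps. The RUNG (crux 2,
LongExchangeSound) generalises exactly ONE hypothesis of the floor — the ARITY of the exchange move:
a step may now derive P_J from a pivot
p ∈ J, an s-set Q ⊆ J−p and an (s+1)-set U disjoint from J through the (s+2)-term single-pivot
Plücker relation
P_J · P_K = Σ_(u∈U) ±P_(J−p+u) · P_((J−Q+U)−u), K = (J−p−Q) ∪ U, at declared cost 2s+3 (s = 1 is the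
octahedral step verbatim, cost 5, so
`ExchangeSound 1` IS the floor: bc/LongExchangeSound_special.lean). X = LongExchangeSound ∧
ShortLongCondensation, where the CARRIER
(crux 3, ShortLongCondensation; the residual) says: for every ε > 0 and all large n some m' ≥ n
admits a valid long-exchange derivation of
weighted length Σ(2·gᵢ+3) ≤ n^(2+ε) listing [n,2n). X ⇒ (tree theorem DerivationsBoundOmega_of,
Baur–Strassen bridge) ω ≤ 2+ε for all ε ⇒ ω = 2.
No card is realised (forward seat).
Lean: `LongExchangeSound ∧ ShortLongCondensation`

## Assembly
Pure logic plus two tree theorems used BY NAME in `closes` (glue.lean, sorry-free, certified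
natively): fix ε > 0; ShortLongCondensation gives, for
all large n, an m' and a valid weighted derivation of cost s = Σ(2gᵢ+3) ≤ n^(2+ε) listing [n,2n);
LongExchangeSound turns it into
`Derivable ℂ s (entries) {det X}`; `Theorems.DerivationsBoundOmega.DerivationsBoundOmega_of (2+ε)`
(Baur–Strassen + Strassen division removal +
ω̃ = ω, landed for the parent route) gives ω ≤ 2+ε; `le_of_forall_pos_le_add` and `omega_two_le`
give ω = 2, i.e. `MatrixMultiplication` via
`MatrixMultiplication_iff`.

Rationale: WHY THIS LINE. The parent route CondensationDistance bets that non-monotone OCTAHEDRAL (arity-1)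
moves shortcut Dodgson's cubic pyramid; its own kill
criterion already names the pivot "auxiliary-column / long-relation variant (k-term
Grassmann–Plücker steps at cost k)", and the landed
negative lemma Theorems/ShortCondensation/Negative/LevelCoverage.lean shows the octahedral
light-cone forces l ≥ (π²/6−1)·n² coordinates level by
level — a counting argument that is BLIND to long moves, because an arity-s step jumps s levels of
the Johnson scheme J(n+m',n) at once
(Laplace expansion along a column is the extreme case s = n−1, divisor P_[n] = 1). This route files
that variant honestly and forward: the
soundness half is the next rung over a proved floor (same simulation engine:
`det_mul_det_eq_sum_det_updateCol` already landed as the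
parent's stub_threeTerm gives the (s+2)-term relation after restricting the Laplace sum to the
columns of U; the cost 2s+3 is met by folding
the signs and the divisor into the free scalars of `lin` steps), and the existence half is the
weakest typed statement carrying the rung to
ω = 2 through the tree's Baur–Strassen bridge [BurgisserClausenShokrollahi1997, BaurStrassen1983].
Imported areas: total positivity /
cluster-algebra exchange relations on the Grassmannian [FominGrigorievKoshevoy2014,
FallatJohnson2011] supply the move set; algebraic complexity
supplies the bridge. What it does that the parent does not: weighted small-n data already separate
the models (Laplace-with-sharing costs
22, 67 < Dodgson's 25, 70 at n = 3, 4), and the parent's only refutation engine (level coverage)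
does not apply.

RANKED CRUXES. #2 LongExchangeSound (crux) — THE RUNG (floor CondensationSound with the arity
hypothesis generalised). For every n ≤ m', every list f of n-subsets of Fin (n+m') with declared
arities g, if each step i is either (gᵢ = 1 and a valid octahedral step, verbatim as in the floor)
or (gᵢ ≥ 2, #fᵢ = n, and for some pivot p ∈ fᵢ, Q ⊆ fᵢ−p with #Q = gᵢ, U disjoint from fᵢ with #U =
gᵢ+1, the divisor (fᵢ−p−Q)∪U and the 2gᵢ+2 mates fᵢ−p+u, ((fᵢ−Q)∪U)−u (u ∈ U) are free (#J = n, at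
most one element ≥ n) or listed earlier), and some fᵢ is the target [n,2n), then det X_n is
derivable with division from the entries in Σᵢ(2·gᵢ+3) steps over ℂ. [difficulty: M] (why it might
fail: cost 2s+3 has no slack: it needs every sign and the divisor folded into `lin` scalars and the
2s+2 mates pairwise distinct as typed; a pivot/position configuration with an extra surviving
Laplace term, or two coinciding mates `((fᵢ \ Q) ∪ U).erase u`, breaks it (repair 2s+4).)
[FallatJohnson2011, FominGrigorievKoshevoy2014, BurgisserClausenShokrollahi1997, Bareiss1968]
#3 ShortLongCondensation (crux) — THE CARRIER (residual; weakest typed statement taking the rung to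
the summit). For every ε > 0 there is n₀ such that for all n ≥ n₀ some m' ≥ n admits a list f with
arities g, valid in the sense of crux 2, of weighted length Σᵢ(2·gᵢ+3) ≤ n^(2+ε), listing the target
[n,2n) (= det X_n). [deps: LongExchangeSound] [difficulty: open-problem] (why it might fail: long
moves may buy only constants: weighted Laplace-with-sharing (22, 67, 176, 429) loses to Dodgson (25,
70, 150, 275) from n = 5 on, hybrids examined re-enter a cubic pyramid, and a weighted long analogue
of level coverage may restore an Ω(n³) bound.) [Dodgson1867, CarterJohnson2021,
FominGrigorievKoshevoy2014, BurgisserClausenShokrollahi1997]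

TWO-LAYER PLAN. Foreseen once LongExchangeSound closes (its registered birth skeleton
bc/LongExchangeSound_birth.lean already has this shape, as stubs not items):
LongExchangeSound ⇐ LongExchangeIdentity (the signed (s+2)-term relation for the concrete minors of
[I|X|Y], from `det_mul_det_eq_sum_det_updateCol`)
→ LongSimulation (abstract-field simulation: ball + nonvanishing + 3-term + long exchange ⇒
Derivable at cost Σ(2gᵢ+3)) → LongExchangeSound.
For the carrier: ShortLongCondensation ⇐ LongHalfTransport (a quadratic-weighted valid derivation
listing every n-set within distance 1 of the
half-shifted window) → LongRecursion (half-transport iterated O(log n) times reaches [n,2n)) →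
ShortLongCondensation (bc/ShortLongCondensation_birth.lean).

KILL CRITERIA. Refuted outright by a theorem `¬ ShortLongCondensation`, e.g. a weighted long
analogue of TightCubicBarrier / LevelCoverage: every valid
long-exchange derivation listing [n,2n) has Σ(2gᵢ+3) ≥ c·n^(2+δ) for some δ > 0 uniformly in m'
(close --reason refuted:ShortLongCondensation;
the census then records that single-pivot Plücker closure is polynomially slower than circuits). A
refutation of LongExchangeSound by a
sign/multiplicity counterexample at some arity is class `misstated`: repair = cost 2s+4 (the floor
still specialises via `Derivable.mono`).
Pivot if the carrier dies but the rung lands: multi-pivot (general Sylvester / Garnir) exchange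
moves, filed as the next rung of the same
family. Mooted if ShortCondensation (parent, stmt-15936) is proved (then ω = 2 already) — this
route's carrier is implied by it.

NOT DECOMPOSED YET. The carrier is deliberately one item: no regime split (m' polynomial vs
unbounded), no explicit derivation family (Laplace hybrids,
half-transport recursion), no constants — those are layer-2 children after the rung closes and after
the cheapest falsifier below reports.
The sign bookkeeping of the long identity and the `DivStep` cost accounting are stubs of the
registered skeleton, not items.

CHEAPEST FALSIFIER. (rung) The signed identity P_J·P_K = Σ_(u∈U) ±P_(J−p+u)·P_((J−Q+U)−u) with
pairwise-distinct mates and exactly 2s+3 listed sets: checked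
numerically on 200 random instances (n ≤ 5, s ≤ 4, random p, Q, U incl. identity columns;
tmp/check_exchange.py): 200/200 hold, 0 failures.
(carrier) Exact minimum weighted cost W(n) of a valid long-exchange derivation of [n,2n) for n = 4,
5 (m' = n and m' = n+2) by ILP/SAT via kit:
W(4) ≤ 67 < 70 = weighted Dodgson is already known by hand (Laplace with shared minors); W(5) < 150
would be the first evidence that long
moves beat Dodgson where pure Laplace (176) does not; W(5) = 150 and W(6) = 275 would make the route
dormant.

NUMBERS. Weighted Dodgson (all steps arity 1): 5·(n−1)n(2n−1)/6 = 25, 70, 150, 275, 455, 700 for n =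
3..8 [Dodgson1867, CarterJohnson2021 p.4:
(3m²n−m³−3mn+m)/6 condensation steps]. Laplace along a column with all minors shared (arity j−1 at
level j): Σ_(j=2..n) C(n,j)(2j+1) = 22, 67,
176, 429, 1002, 2279. Octahedral level-coverage bound (parent, landed): l ≥ (π²/6−1)·n² ≈ 0.64·n² —
not applicable to long steps.
Target: Σ(2gᵢ+3) ≤ n^(2+ε).

DEFINITION REQUESTS. None: everything is stated over Finset / Matrix / MvPolynomial / FractionRing
and the tree's `Derivable`.

Novelty: Searches (2026-08-17): lit search --hybrid "long Plücker relations Laplace expansion exchange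
determinant algorithm cost" (8 docs, 0 relevant);
lit vsearch "computing a determinant by a sequence of Grassmann-Plücker exchange relations, counting
steps" (8, 0 relevant; nearest
[corpus:book:burgisser1997 pp.180-192] generic); lit search `"Dodgson condensation" complexity` (5;
[corpus:paper:arxiv-2103.08742 p.4] cubic count);
lit search `"Plücker relations" algorithm minors exchange` (2 generic: arxiv-1009.2936 p.5,
arxiv-1804.01595 p.3); lit search --problem
MatrixMultiplication `determinant "lower bound" minors restricted` (8; arxiv-2112.00792 p.38
determinantal-ideal lower bounds, not this model);
lit vsearch "lower bounds for computing the determinant in restricted models" (8;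
[corpus:book:borodin1975 p.78], [corpus:paper:arxiv-1704.04163 p.47]
citing Klyuev–Kokovkin-Shcherbak 1965: elimination optimal among row/column-operation algorithms);
lit galaxy search "Plücker relations|Plucker
relations" --star pdf (10, geometry/integrable-systems, 0 on complexity:
[galaxy:pdf:-2264246432832497140] T-systems); lit galaxy search "Dodgson
condensation" --star pdf (10; [galaxy:pdf:5681710470259405800] = CarterJohnson2021;
[galaxy:pdf:-1596587106442112740] Kuo graphical condensation);
lit galaxy search --star all / panama "Grassmann-Plücker|Plucker relations" ×3: queued-too-long
(saturated), 1 run returned 10 generic textbook rows;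
ledger negatives --problem MatrixMultiplication (12, non  [refs: book:burgisser1997, paper:arxiv-2103.08742, arxiv-1009.2936, arxiv-1804.01595, arxiv-2112.00792, book:borodin1975, paper:arxiv-1704.04163, CarterJohnson2021, FominGrigorievKoshevoy2014]

Barriers (technique_class: determinant-complexity, plucker-closure, long-exchange): - technique_class: determinant-complexity, plucker-closure, long-exchange
- Literature.Barriers.MatrixMultiplication.UniversalMethodBarrier: outside its class — it bounds
ω-upper-bounds obtained by degenerating powers of a fixed tensor (CW-type); this line produces an
explicit division SLP for det_n and uses Baur–Strassen, no tensor restriction/degeneration of a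
fixed starting tensor occurs.
- Literature.Barriers.MatrixMultiplication.IrreversibilityBarrier: outside — same reason (no
intermediate tensor whose irreversibility caps the method); the SLP is built directly.
- Literature.Barriers.MatrixMultiplication.TricoloredSumFreeBarrier: outside — no group-theoretic /
STPP construction.
- Literature.Barriers.MatrixMultiplication.YoungSubgroupBarrier: outside — no group embedding.
- Literature.Barriers.MatrixMultiplication.NilpotentGroupBarrier: outside — no group embedding.
- Literature.Barriers.MatrixMultiplication.QuasirandomBarrier: outside — no group embedding.
- Literature.Barriers.MatrixMultiplication.NormalizerBarrier: outside — no group embedding.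
- Literature.Barriers.MatrixMultiplication.LinearRankMethodBarrier: outside — it caps LOWER-bound
methods (rank/flattening); this line is an upper-bound construction.
- Literature.Barriers.MatrixMultiplication.BoundedRankFrameBarrier: outside — no laser-method frame.
- Literature.Barriers.MatrixMultiplication.EquivoluminousBarrier: outside — no laser-method
distribution.
- Literature.Barriers.MatrixMultiplication.GradedPacking

sub-problem: MatrixMultiplication · status: draft · opened planner-fwd-rung-MatrixMultiplication-02-0 2026-08-17T19:13:25Z · rev 0 · ledger route-MatrixMultiplication-LongExchangeCondensation
GENERATED by the gate from the ledger (D-0016/17). Provers cite these decls: `theorem foo : Summit.MatrixMultiplication.MatrixMultiplication.Theses.LongExchangeCondensation.<Decl> := …` in Summits/MatrixMultiplication/MatrixMultiplication/Theorems/<Name>.lean.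
-/

namespace Summit.MatrixMultiplication.MatrixMultiplication.Theses.LongExchangeCondensation

open scoped BigOperators Topology Manifold Classical MeasureTheory ProbabilityTheory Matrix InnerProductSpace ComplexConjugate ContinuousMap
open Filter Set Function TopologicalSpace MeasureTheory

attribute [summit_statement] _root_.MatrixMultiplication

/-- item stmt-MatrixMultiplication-20136 · crux · rank 2 · closed · proved by Summit.MatrixMultiplication.MatrixMultiplication.Theorems.LongExchangeSound.LongExchangeSound_of @ e86d25bd1260 (prover) · by planner
why it might fail: cost 2s+3 has no slack: it needs every sign and the divisor folded into `lin` scalars and the 2s+2 mates pairwise distinct as typed; a pivot/position configuration with an extra surviving Laplace term, or two coinciding mates `((fᵢ \ Q) ∪ U).erase u`, breaks it (repair 2s+4).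
sources: FallatJohnson2011, FominGrigorievKoshevoy2014, BurgisserClausenShokrollahi1997, Bareiss1968
[crux] THE RUNG (floor CondensationSound with the arity hypothesis generalised). For every n ≤ m',
every list f of n-subsets of Fin (n+m') with declared arities g, if each step i is either (gᵢ = 1
and a valid octahedral step, verbatim as in the floor) or (gᵢ ≥ 2, #fᵢ = n, and for some pivot p ∈
fᵢ, Q ⊆ fᵢ−p with #Q = gᵢ, U disjoint from fᵢ with #U = gᵢ+1, the divisor (fᵢ−p−Q)∪U and the 2gᵢ+2
mates fᵢ−p+u, ((fᵢ−Q)∪U)−u (u ∈ U) are free (#J = n, at most one element ≥ n) or listed earlier),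
and some fᵢ is the target [n,2n), then det X_n is derivable with division from the entries in
Σᵢ(2·gᵢ+3) steps over ℂ. [difficulty: M] -/
@[route_item "route-MatrixMultiplication-LongExchangeCondensation", crux]
def LongExchangeSound : Prop :=
  ∀ (n m' : ℕ) (h : n ≤ m') (l : ℕ) (f : Fin l → Finset (Fin (n + m'))) (g : Fin l → ℕ), (∀ i : Fin l, (g i = 1 ∧ ∃ p ∈ f i, ∃ q ∈ f i, p ≠ q ∧ ∃ u ∉ f i, ∃ v ∉ f i, u ≠ v ∧ ∀ J ∈ [insert u ((f i).erase p), insert v ((f i).erase p), insert u ((f i).erase q), insert v ((f i).erase q), insert u (insert v (((f i).erase p).erase q))], (J.card = n ∧ (J.filter fun x : Fin (n + m') => n ≤ x.val).card ≤ 1) ∨ ∃ j : Fin l, j < i ∧ f j = J) ∨ (2 ≤ g i ∧ (f i).card = n ∧ ∃ p ∈ f i, ∃ Q ⊆ (f i).erase p, Q.card = g i ∧ ∃ U : Finset (Fin (n + m')), (∀ u ∈ U, u ∉ f i) ∧ U.card = g i + 1 ∧ ∀ J ∈ insert (((f i).erase p \ Q) ∪ U) (U.image (fun u => insert u ((f i).erase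 p)) ∪ U.image (fun u => ((f i \ Q) ∪ U).erase u)), (J.card = n ∧ (J.filter fun x : Fin (n + m') => n ≤ x.val).card ≤ 1) ∨ ∃ j : Fin l, j < i ∧ f j = J)) → (∃ i : Fin l, f i = Finset.univ.filter fun x : Fin (n + m') => n ≤ x.val ∧ x.val < 2 * n) → Literature.Computability.AlgebraicComplexity.Derivable ℂ (∑ i : Fin l, (2 * g i + 3)) (Set.range fun p : Fin n × Fin m' => algebraMap (MvPolynomial (Fin n × Fin m') ℂ) (FractionRing (MvPolynomial (Fin n × Fin m') ℂ)) (MvPolynomial.X p)) {algebraMap (MvPolynomial (Fin n × Fin m') ℂ) (FractionRing (MvPolynomial (Fin n × Fin m') ℂ)) (Matrix.det (Matrix.of fun i j : Fin n => MvPolynomial.X (i, Fin.castLE h j)))}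

/-- item stmt-MatrixMultiplication-20137 · crux · rank 3 · open · by planner
why it might fail: long moves may buy only constants: weighted Laplace-with-sharing (22, 67, 176, 429) loses to Dodgson (25, 70, 150, 275) from n = 5 on, hybrids examined re-enter a cubic pyramid, and a weighted long analogue of level coverage may restore an Ω(n³) bound.
sources: Dodgson1867, CarterJohnson2021, FominGrigorievKoshevoy2014, BurgisserClausenShokrollahi1997
[crux] THE CARRIER (residual; weakest typed statement taking the rung to the summit). For every ε >
0 there is n₀ such that for all n ≥ n₀ some m' ≥ n admits a list f with arities g, valid in the
sense of crux 2, of weighted length Σᵢ(2·gᵢ+3) ≤ n^(2+ε), listing the target [n,2n) (= det X_n).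
[deps: LongExchangeSound] [difficulty: open-problem] -/
@[route_item "route-MatrixMultiplication-LongExchangeCondensation", crux]
def ShortLongCondensation : Prop :=
  ∀ ε : ℝ, 0 < ε → ∃ n₀ : ℕ, ∀ n ≥ n₀, ∃ m' : ℕ, n ≤ m' ∧ ∃ (l : ℕ) (f : Fin l → Finset (Fin (n + m'))) (g : Fin l → ℕ), ((∑ i : Fin l, (2 * g i + 3) : ℕ) : ℝ) ≤ (n : ℝ) ^ (2 + ε) ∧ (∀ i : Fin l, (g i = 1 ∧ ∃ p ∈ f i, ∃ q ∈ f i, p ≠ q ∧ ∃ u ∉ f i, ∃ v ∉ f i, u ≠ v ∧ ∀ J ∈ [insert u ((f i).erase p), insert v ((f i).erase p), insert u ((f i).erase q), insert v ((f i).erase q), insert u (insert v (((f i).erase p).erase q))], (J.card = n ∧ (J.filter fun x : Fin (n + m') => n ≤ x.val).card ≤ 1) ∨ ∃ j : Fin l, j < i ∧ f j = J) ∨ (2 ≤ g i ∧ (f i).card = n ∧ ∃ p ∈ f i, ∃ Q ⊆ (f i).erase p, Q.card = g i ∧ ∃ U : Finset (Fin (n + m')), (∀ u ∈ U, u ∉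 f i) ∧ U.card = g i + 1 ∧ ∀ J ∈ insert (((f i).erase p \ Q) ∪ U) (U.image (fun u => insert u ((f i).erase p)) ∪ U.image (fun u => ((f i \ Q) ∪ U).erase u)), (J.card = n ∧ (J.filter fun x : Fin (n + m') => n ≤ x.val).card ≤ 1) ∨ ∃ j : Fin l, j < i ∧ f j = J)) ∧ ∃ i : Fin l, f i = Finset.univ.filter fun x : Fin (n + m') => n ≤ x.val ∧ x.val < 2 * n

/-- item stmt-MatrixMultiplication-20138 · assembly · rank 1 · closed · proved by Summit.MatrixMultiplication.MatrixMultiplication.Theorems.LongExchangeCondensationAssembly.Assembly_of @ ca55543c4ed3 (prover) · by planner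
sources: BurgisserClausenShokrollahi1997, BaurStrassen1983
[assembly] LongExchangeSound → ShortLongCondensation → ω(ℂ) = 2. -/
@[route_item "route-MatrixMultiplication-LongExchangeCondensation"]
def Assembly : Prop :=
  LongExchangeSound → ShortLongCondensation → _root_.MatrixMultiplication

/-! D-0027 §2.1 — DECIDING THEOREM (planner-authored via `route open/edit --closes-file`; by planner-fwd-rung-MatrixMultiplication-02-0 2026-08-17T19:13:25Z):
its hypotheses are this route's items and its conclusion the sub-problem Statement (glue_lint), and it elaborates with this file. -/

@[closes "route-MatrixMultiplication-LongExchangeCondensation"] theorem closes (hR : LongExchangeSound) (hX : ShortLongCondensation) : _root_.MatrixMultiplication := by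
  rw [MatrixMultiplication_iff]
  refine le_antisymm ?_ (Literature.Computability.AlgebraicComplexity.omega_two_le ℂ)
  refine le_of_forall_pos_le_add fun ε hε => ?_
  refine Summit.MatrixMultiplication.MatrixMultiplication.Theorems.DerivationsBoundOmega.DerivationsBoundOmega_of
    (2 + ε) (by linarith) ?_
  obtain ⟨n₀, h⟩ := hX ε hε
  refine ⟨1, n₀, fun n hn => ?_⟩
  obtain ⟨m', hnm, l, f, g, hcost, hvalid, hhit⟩ := h n hn
  exact ⟨m', hnm, ∑ i : Fin l, (2 * g i + 3), by simpa using hcost, hR n m' hnm l f g hvalid hhit⟩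

end Summit.MatrixMultiplication.MatrixMultiplication.Theses.LongExchangeCondensation
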